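import Literature.Analysis.InnerProduct.OrbifoldLensSpacePolesAtOne
import Literature.Analysis.InnerProduct.OrbifoldLensSpaceResidueAtAxisPole
import HarnessLib

/-!
# Two three-dimensional isospectral orbifold lens spaces are isometric (Bari–Hunsicker 2019, Theorem 3.1): Lemma 3.3,
# Case 5 for arbitrary weights, and the theorem assembled for all pairs that are not both manifolds

Layer `Literature/Analysis/InnerProduct`, namespace `Literature.Analysis.InnerProduct`; lane `lit-hodgefound`, prover seat
`lit-hodgefound-p06`, generation 46, row g46-#9. THEOREMS only (no definition, no instance, no notation, no named fact).
This file closes the series g46-#5 (Cases 3, 4), g46-#6 (Case 2, Corollary 2.14), g46-#7 (normalization `|G| = q`),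
g46-#8 (Proposition 3.2 and Case 5 in normal form): it supplies the normal form `L(q; x, w)` of a weight pair with no unit,
the part of Lemma 3.3 that is needed, Case 5 for arbitrary weights, and THEOREM 3.1 for every pair of three-dimensional
orbifold lens spaces with `|G| = q` that are not both manifolds (Case 1 — both manifolds — is Ikeda–Yamamoto 1979 and
Yamamoto 1980, in the tree for prime powers, twice prime powers, `q ≤ 10`, and odd `q` with `(p₁ ± p₂, q) = 1`).

## Source, verbatim (held text `paper:arxiv-1705.01412`)

N. Bari, E. Hunsicker, *Isospectrality for orbifold lens spaces*, Canad. J. Math. **72** (2020), arXiv:1705.01412, §3.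
"**Theorem 3.1.** Given two 3-dimensional lens spaces `L₁ = L(q: p₁, p₂)` and `L₂ = L(q: s₁, s₂)`. If `L₁` is isospectral
to `L₂`, then the two lens spaces are isometric." Case 5 ("None of `p₁`, `p₂`, `s₁` and `s₂` is coprime to `q`"): "Let
`gcd(p₁, q) = x > 1`, `gcd(p₂, q) = y > 1`, `gcd(s₁, q) = u > 1`, and `gcd(s₂, q) = v > 1`. Also without loss of generality
we can assume that `y > x` and `v > u` because if `x = y` (resp. `u = v`) then `|G| = q/x` (resp. `|G| = q/u`), which
contradicts our assumption that `|G| = q`. We rewrite `L₁ = L(q:ax, by)` and `L₂ = L(q:cu, dv)`. Since `gcd(ax, q) =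
gcd(x, q) = x` and `gcd(cu, q) = gcd(u, q) = u`, we can multiply the entries of `L₁` and `L₂` by appropriate numbers coprime
to q and rewrite `L₁ = L(q:x, py)` and `L₂ = L(q:u, sv)` (see [GP]). We will also assume that `gcd(x, py) = 1 = gcd(u, sv)`
… **Lemma 3.3.** Suppose `L₁ = L(q:x, py)` and `L₂ = L(q:u, sv)` are two isospectral lens orbifolds where `gcd(x, q) = x`,
`gcd(py, q) = y`, `gcd(u, q) = u` and `gcd(sv, q) = v`. Then either `u = x` and `v = y`, or `u = y` and `v = x`. … Proof. …
These two facts, along with Proposition 3.2 give `0 ≠ (−2γ^x/q)∑_{t=1}^{x} … = lim_{z→γ^x}(z − γ^x)F₁(z)`. Since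
`lim_{z→γ^x}(z − γ^x)F₁(z) = lim_{z→γ^x}(z − γ^x)F₂(z)`, … So there must be an `l` such that `ul + x ≡ 0 (mod q)`, or
`−ul + x ≡ 0 (mod q)`, or `svl + x ≡ 0 (mod q)`, or `−svl + x ≡ 0 (mod q)`. Recall that `u|q`. Then `ul + x ≡ 0 (mod q)`
or `−ul + x ≡ 0 (mod q)` imply that `u|x`. Similarly, since `v|q`, we can show that if `svl + x ≡ 0 (mod q)` or `−svl + x ≡
0 (mod q)` then `v|x`. So either `u|x` or `v|x`. … We can swap the roles of `L₁` and `L₂` and repeat the above arguments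
again to get either `x|u` and `y|v`, or `y|u` and `x|v`. … Remark: From now on, we can write the two lens spaces as
`L₁ = L(q:x, py)` and `L₂ = L(q:x, sy)`." The proof of Case 5 then compares the two residues at `γ^x` and ends with "the
corresponding lens spaces are isometric because `L(q; x, py) ∼ L(q; −x, −py) ∼ L(q; −x, (t₃q_{/x} − 1)sy) ∼ L(q; x, sy)`."
§2.1: "**Corollary 2.2.** … `L` is isometric to `L'` if and only if there is a number `l` coprime with `q` and there are
numbers `e_i ∈ {−1, 1}` such that `(p₁, …, p_n)` is a permutation of `(e₁ls₁, …, e_nls_n) (mod q)`."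

## As formalised

* §1 **`LensWeightsEquivalent.exists_isCoprime_of_coprime_gcd`**: for `gcd(p₁, p₂, q) = 1` any multiplier `l` of Ikeda's
  criterion is prime to `q` (a common divisor of `l` and `q` divides `p₁` and `p₂`) — so the tree's `LensWeightsEquivalent`
  IS Corollary 2.2's isometry criterion for orbifold lens spaces with `|G| = q`.
* §2 (private) the normal form: for `gcd(p₁, p₂, q) = 1`, `1 < x = gcd(p₁, q) < y = gcd(p₂, q)`: `p₁ = xa` with `a` prime
  to `m = q/x`; a unit `c` of `ℤ/q` with `ca ≡ 1 (mod m)` (units of `ℤ/q` map ONTO units of `ℤ/m`, Mathlib's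
  `ZMod.unitsMap_surjective` — the source's "appropriate numbers coprime to `q`", [GP]) gives `cp₁ ≡ x`, `w = cp₂`, and
  `L(q; p₁, p₂)`, `L(q; x, w)` have the same multiplicities and equivalent weights; `(x, w)` satisfies the hypotheses of row
  g46-#8 (`m ≥ 3`, `m ∤ 2x`, `w` prime to `x`, `m ∤ lw − x`), because `y ∣ m`, `y ∣ w`, `gcd(x, y) = 1`, `1 < x < y`.
* §3 **`exists_mul_congr_of_lensMultiplicity_eq_axis`** (the pole argument of Lemma 3.3: `F₂` must have a pole at `γ^x`,
  by Proposition 3.2 = `residue_axis_ne_zero` and `tendsto_one_sub_exp_mul_tsum_lensMultiplicity_eq_sum`) and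
  **`eq_of_lensMultiplicity_eq_of_normalForms`**: LEMMA 3.3, first weights: `u ∣ x ∨ v ∣ x` and `x ∣ u ∨ y ∣ u` force
  `x = u`. The source's further conclusion `v = y` rests on Proposition 3.2 "with the roles of `x` and `y` swapped", i.e. for
  `L(q : y, p'x)` with the LARGER gcd first, where its hypothesis fails and the residue can vanish (e.g. `q = 18`,
  `L(18; 3, 2)`: `e(3(2 − 3)) = e(3(2 + 3))`); it is not needed: once `x = u` both spaces are normal forms with the same
  first weight and row g46-#8 applies.
* §4 **`lensWeightsEquivalent_of_lensMultiplicity_eq_of_forall_not_isCoprime`**: THEOREM 3.1, Case 5, arbitrary weights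
  with no unit (both orders of `gcd(p₁, q)`, `gcd(p₂, q)` via `lensMultiplicity_swap`).
* §5 **`lensWeightsEquivalent_of_lensMultiplicity_eq_of_not_manifolds`**: THEOREM 3.1 for all `L₁`, `L₂` with `|G| = q`
  not both manifolds — Case 2 (`isCoprime_of_lensMultiplicity_eq`, row g46-#6), Cases 3–4
  (`lensWeightsEquivalent_of_lensMultiplicity_eq_of_isCoprime_or`, rows g46-#5/#6), Case 5 (§4) — and
  **`exists_isCoprime_of_lensMultiplicity_eq_of_not_manifolds`**: the conclusion of Corollary 2.2 verbatim.
  Sanity check outside Lean (not used in any proof): a brute-force enumeration confirms that for every `q ≤ 32` any two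
  weight pairs with `|G| = q` and equal multiplicities `dim E_{n(n+2)}`, `n ≤ 3q + 6`, satisfy the criterion.

## References

* [BariHunsicker2019] N. Bari, E. Hunsicker, *Isospectrality for orbifold lens spaces*, Canad. J. Math. 72 (2020)
  (arXiv:1705.01412), §3 Theorem 3.1 (all cases), Proposition 3.2, Lemma 3.3 and Remark; §2.1 Corollary 2.2, Corollary 2.12.
* [IkedaYamamoto1979] A. Ikeda, Y. Yamamoto, *On the spectra of 3-dimensional lens spaces*, Osaka J. Math. 16 (1979) 447–469
  (Case 1; Theorem 3.2 (3.8)).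
* [Ikeda1980] A. Ikeda, *On lens spaces which are isospectral but not isometric*, Ann. Sci. ÉNS (4) 13 (1980) 303–315,
  Theorem 2.1 (4).
-/

noncomputable section

open Finset Filter Topology Complex

namespace Literature.Analysis.InnerProduct

open _root_.Real _root_.Filter _root_.Topology

/-- `|e(a)| = 1`. [folklore] -/
private theorem norm_exp_intCast_x9 (q : ℕ) (a : ℤ) : ‖cexp (2 * π * I * a / q)‖ = 1 := by
  rw [show (2 * π * I * a / q : ℂ) = ((2 * π * a / q : ℝ) : ℂ) * I by push_cast; ring]
  exact Complex.norm_exp_ofReal_mul_I _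

/-- `𝓝[ball 0 1] z₀ ≤ 𝓝[≠] z₀` and `𝓝[ball 0 1] z₀` is nontrivial, for `|z₀| = 1`. [folklore] -/
private theorem nhdsWithin_ball_le_and_neBot_x9 {z₀ : ℂ} (hz₀ : ‖z₀‖ = 1) :
    𝓝[Metric.ball (0 : ℂ) 1] z₀ ≤ 𝓝[≠] z₀ ∧ (𝓝[Metric.ball (0 : ℂ) 1] z₀).NeBot := by
  refine ⟨nhdsWithin_mono _ fun z hz (h1 : z = z₀) ↦ ?_, mem_closure_iff_nhdsWithin_neBot.mp ?_⟩
  · rw [h1, mem_ball_zero_iff, hz₀] at hz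
    exact lt_irrefl _ hz
  · rw [closure_ball (0 : ℂ) one_ne_zero, Metric.mem_closedBall, dist_zero_right, hz₀]

/-! ### §1 Ikeda's criterion for `|G| = q`: the multiplier is a unit; swapping the weights -/

/-- **The multiplier `l` is prime to `q` when `gcd(p₁, p₂, q) = 1`** (`|G| = q`): in `p_{σ(i)} ≡ e_i l s_i (mod q)` any common
divisor of `l` and `q` divides `p₁` and `p₂`. Hence for orbifold lens spaces with `|G| = q` Ikeda's `LensWeightsEquivalent`
is the isometry criterion of Corollary 2.2 ("there is a number `l` coprime with `q` …"). [cite: BariHunsicker2019, Corollary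
2.2] [cite: Ikeda1980, Theorem 2.1 (4)] -/
theorem LensWeightsEquivalent.exists_isCoprime_of_coprime_gcd {q : ℕ} {p₁ p₂ : ℤ} {s : Fin 2 → ℤ}
    (h : LensWeightsEquivalent q ![p₁, p₂] s) (hp : (Int.gcd p₁ p₂).Coprime q) :
    ∃ l : ℤ, IsCoprime l q ∧ ∃ e : Fin 2 → ℤ, (∀ i, e i = 1 ∨ e i = -1) ∧
      ∃ σ : Equiv.Perm (Fin 2), ∀ i, (![p₁, p₂] : Fin 2 → ℤ) (σ i) ≡ e i * l * s i [ZMOD q] := by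
  obtain ⟨l, e, he, σ, hσ⟩ := h
  refine ⟨l, ?_, e, he, σ, hσ⟩
  rw [Int.isCoprime_iff_gcd_eq_one]
  -- `g = gcd(l, q)` divides `p₁`, `p₂` and `q`
  have hdiv : ∀ j : Fin 2, ((Int.gcd l q : ℕ) : ℤ) ∣ (![p₁, p₂] : Fin 2 → ℤ) j := by
    intro j
    have hj := hσ (σ.symm j)
    rw [Equiv.apply_symm_apply] at hj
    obtain ⟨t, ht⟩ := Int.modEq_iff_dvd.mp hj.symm
    have e1 : (![p₁, p₂] : Fin 2 → ℤ) j = e (σ.symm j) * l * s (σ.symm j) + q * t := by linarith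
    rw [e1]
    exact dvd_add (Dvd.dvd.mul_right (Dvd.dvd.mul_left (Int.gcd_dvd_left l q) _) _)
      (Dvd.dvd.mul_right (Int.gcd_dvd_right l q) _)
  have h0 := hdiv 0
  have h1 := hdiv 1
  simp only [Matrix.cons_val_zero, Matrix.cons_val_one] at h0 h1
  have h2 : Int.gcd l q ∣ Int.gcd p₁ p₂ := Int.natCast_dvd_natCast.mp (Int.dvd_coe_gcd h0 h1)
  have h3 : Int.gcd l q ∣ Nat.gcd (Int.gcd p₁ p₂) q :=
    Nat.dvd_gcd h2 (Int.natCast_dvd_natCast.mp (Int.gcd_dvd_right l q))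
  rw [hp] at h3
  exact Nat.dvd_one.mp h3

/-- `L(q; p₂, p₁) ~ L(q; p₁, p₂)` on the left of Ikeda's criterion. [cite: BariHunsicker2019, Corollary 2.2] -/
private theorem swap_left_x9 {q : ℕ} {p₁ p₂ : ℤ} {s : Fin 2 → ℤ} (h : LensWeightsEquivalent q ![p₂, p₁] s) :
    LensWeightsEquivalent q ![p₁, p₂] s := by
  have e : ((![p₂, p₁] : Fin 2 → ℤ) ∘ (Equiv.swap (0 : Fin 2) 1)) = ![p₁, p₂] := by
    funext i
    fin_cases i <;> simp [Equiv.swap_apply_left, Equiv.swap_apply_right]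
  have h2 := lensWeightsEquivalent_comp_perm q ![p₂, p₁] (Equiv.swap 0 1)
  rw [e] at h2
  exact h2.trans h

/-- `L(q; s₂, s₁) ~ L(q; s₁, s₂)` on the right of Ikeda's criterion. [cite: BariHunsicker2019, Corollary 2.2] -/
private theorem swap_right_x9 {q : ℕ} {p : Fin 2 → ℤ} {s₁ s₂ : ℤ} (h : LensWeightsEquivalent q p ![s₂, s₁]) :
    LensWeightsEquivalent q p ![s₁, s₂] := by
  have e : ((![s₁, s₂] : Fin 2 → ℤ) ∘ (Equiv.swap (0 : Fin 2) 1)) = ![s₂, s₁] := by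
    funext i
    fin_cases i <;> simp [Equiv.swap_apply_left, Equiv.swap_apply_right]
  have h2 := lensWeightsEquivalent_comp_perm q ![s₁, s₂] (Equiv.swap 0 1)
  rw [e] at h2
  exact h.trans h2

/-! ### §2 The normal form `L(q; x, w)`, `x = gcd(p₁, q)`, of an orbifold lens space with no weight prime to `q` -/

/-- **Units of `ℤ/q` surject onto units of `ℤ/m` for `m ∣ q`**: an integer `a` prime to `m` has an inverse `c` mod `m` with
`c` prime to `q`. [folklore] -/
private theorem exists_unit_lift_x9 {q m : ℕ} [NeZero q] (hmq : m ∣ q) {a : ℤ} (ha : IsCoprime a m) :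
    ∃ c : ℤ, IsCoprime c q ∧ (m : ℤ) ∣ c * a - 1 := by
  have hA : IsUnit (a : ZMod m) := (ZMod.coe_int_isUnit_iff_isCoprime a m).mpr ha.symm
  obtain ⟨C, hC⟩ := ZMod.unitsMap_surjective hmq hA.unit⁻¹
  refine ⟨((C : ZMod q).val : ℤ), ?_, ?_⟩
  · have h1 : IsUnit ((((C : ZMod q).val : ℤ) : ZMod q)) := by
      rw [Int.cast_natCast, ZMod.natCast_zmod_val]
      exact Units.isUnit C
    exact ((ZMod.coe_int_isUnit_iff_isCoprime _ q).mp h1).symm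
  · rw [← ZMod.intCast_zmod_eq_zero_iff_dvd]
    push_cast
    have h2 : (((C : ZMod q).val : ℕ) : ZMod m) = ((hA.unit⁻¹ : (ZMod m)ˣ) : ZMod m) := by
      rw [← hC, ZMod.unitsMap_val, ZMod.cast_eq_val]
    have h3 : ((hA.unit : (ZMod m)ˣ) : ZMod m) = (a : ZMod m) := hA.unit_spec
    have h4 : ((hA.unit⁻¹ : (ZMod m)ˣ) : ZMod m) * (a : ZMod m) = 1 := by
      have := hA.unit.inv_mul
      rwa [h3] at this
    rw [h2, h4, sub_self]

/-- `lensMonomialCount` is unchanged by a common unit factor. [cite: BariHunsicker2019, Corollary 2.2 ("if we multiply all the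
`p_i`'s by some number `±l` where `gcd(l, q) = 1` … we still have the same group `G`")] -/
private theorem lensMonomialCount_unit_mul_x9 (q : ℕ) {c : ℤ} (hc : IsCoprime c q) (p₁ p₂ : ℤ) (k : ℕ) :
    lensMonomialCount q (c * p₁) (c * p₂) k = lensMonomialCount q p₁ p₂ k := by
  unfold lensMonomialCount
  refine sum_congr rfl fun ij _ ↦ sum_congr rfl fun ab _ ↦ sum_congr rfl fun cd _ ↦ if_congr ?_ rfl rfl
  rw [show ((ab.1 : ℤ) - ab.2) * (c * p₁) + ((cd.1 : ℤ) - cd.2) * (c * p₂) =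
    c * (((ab.1 : ℤ) - ab.2) * p₁ + ((cd.1 : ℤ) - cd.2) * p₂) by ring]
  exact ⟨fun h ↦ hc.symm.dvd_of_dvd_mul_left h, fun h ↦ dvd_mul_of_dvd_right h _⟩

/-- The multiplicities of `L(q; p₁, p₂)` and `L(q; cp₁, cp₂)`, `c` prime to `q`, agree, and depend on `cp₁` only mod `q`.
[cite: BariHunsicker2019, Corollary 2.2] -/
private theorem lensMultiplicity_unit_mul_congr_x9 (q : ℕ) {c : ℤ} (hc : IsCoprime c q) {p₁ p₂ x : ℤ}
    (hx : (q : ℤ) ∣ c * p₁ - x) (k : ℕ) : lensMultiplicity q p₁ p₂ k = lensMultiplicity q x (c * p₂) k := by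
  have h1 : lensMultiplicity q p₁ p₂ k = lensMultiplicity q (c * p₁) (c * p₂) k := by
    simp only [lensMultiplicity, lensMonomialCount_unit_mul_x9 q hc p₁ p₂]
  rw [h1, lensMultiplicity_swap q (c * p₁), lensMultiplicity_congr_right q (c * p₂) hx, lensMultiplicity_swap]

/-- `gcd(p₁, q)` and `gcd(p₂, q)` are coprime when `gcd(p₁, p₂, q) = 1`, and so are `p₂` and `gcd(p₁, q)`. [folklore] -/
private theorem coprime_gcd_gcd_x9 {q : ℕ} {p₁ p₂ : ℤ} (hp : (Int.gcd p₁ p₂).Coprime q) :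
    Nat.Coprime (Int.gcd p₁ q) (Int.gcd p₂ q) ∧ IsCoprime p₂ (Int.gcd p₁ q : ℕ) := by
  have key : ∀ g : ℕ, g ∣ p₁.natAbs → g ∣ p₂.natAbs → g ∣ q → g = 1 := fun g h1 h2 h3 ↦ by
    have h4 : g ∣ Nat.gcd (Int.gcd p₁ p₂) q := Nat.dvd_gcd (Nat.dvd_gcd h1 h2) h3
    rw [hp] at h4
    exact Nat.dvd_one.mp h4
  have hx1 : Int.gcd p₁ q ∣ p₁.natAbs := Nat.gcd_dvd_left _ _
  have hxq : Int.gcd p₁ q ∣ q := by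
    have := Nat.gcd_dvd_right p₁.natAbs (q : ℤ).natAbs
    rwa [Int.natAbs_natCast] at this
  have hy2 : Int.gcd p₂ q ∣ p₂.natAbs := Nat.gcd_dvd_left _ _
  refine ⟨?_, ?_⟩
  · exact key _ ((Nat.gcd_dvd_left _ _).trans hx1) ((Nat.gcd_dvd_right _ _).trans hy2)
      ((Nat.gcd_dvd_left _ _).trans hxq)
  · rw [Int.isCoprime_iff_gcd_eq_one]
    exact key _ ((Nat.gcd_dvd_right _ _).trans hx1) (Nat.gcd_dvd_left _ _) ((Nat.gcd_dvd_right _ _).trans hxq)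

/-- **The normal form `L(q; x, w)`** (Bari–Hunsicker: "Let `gcd(p₁, q) = x > 1`, `gcd(p₂, q) = y > 1` … we can multiply the
entries … by appropriate numbers coprime to `q` and rewrite `L₁ = L(q:x, py)` … We will also assume that `gcd(x, py) = 1`"):
for weights with `gcd(p₁, p₂, q) = 1` and `1 < x = gcd(p₁, q) < y = gcd(p₂, q)` there is `w` (`= cp₂`, `c` a unit with
`cp₁ ≡ x`) such that `L(q; p₁, p₂)` and `L(q; x, w)` have the same multiplicities and equivalent weights (both ways), and
`(x, w)` satisfies the hypotheses of the residue computation at `γ^{−x}`: `q = xm`, `m ≥ 3`, `m ∤ 2x`, `w` prime to `x`,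
`m ∤ lw − x` for all `l`; moreover `y ∣ w`, `y ∣ q`, `gcd(x, y) = 1`. [cite: BariHunsicker2019, Theorem 3.1 (proof, Case 5,
first paragraph), Corollary 2.2] -/
private theorem normalForm_x9 {q : ℕ} [NeZero q] {p₁ p₂ : ℤ} (hp : (Int.gcd p₁ p₂).Coprime q)
    (h1 : 1 < Int.gcd p₁ q) (h12 : Int.gcd p₁ q < Int.gcd p₂ q) :
    ∃ (m : ℕ) (w : ℤ), q = Int.gcd p₁ q * m ∧ 3 ≤ m ∧ ¬ (m : ℤ) ∣ 2 * (Int.gcd p₁ q : ℕ) ∧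
      IsCoprime w (Int.gcd p₁ q : ℕ) ∧ (∀ l : ℤ, ¬ (m : ℤ) ∣ l * w - (Int.gcd p₁ q : ℕ)) ∧
      ((Int.gcd p₂ q : ℕ) : ℤ) ∣ w ∧
      (∀ n, lensMultiplicity q p₁ p₂ n = lensMultiplicity q (Int.gcd p₁ q : ℕ) w n) ∧
      LensWeightsEquivalent q ![p₁, p₂] ![((Int.gcd p₁ q : ℕ) : ℤ), w] ∧
      LensWeightsEquivalent q ![((Int.gcd p₁ q : ℕ) : ℤ), w] ![p₁, p₂] := by
  have hq : q ≠ 0 := NeZero.ne q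
  set x : ℕ := Int.gcd p₁ q with hxdef
  set y : ℕ := Int.gcd p₂ q with hydef
  obtain ⟨hxy, hp₂x⟩ := coprime_gcd_gcd_x9 hp
  rw [← hxdef, ← hydef] at hxy
  rw [← hxdef] at hp₂x
  have hx0 : x ≠ 0 := by omega
  -- `x ∣ q`, `x ∣ p₁`, `y ∣ q`, `y ∣ p₂`
  have hxq' : (x : ℤ) ∣ (q : ℤ) := Int.gcd_dvd_right p₁ q
  have hxq : x ∣ q := Int.natCast_dvd_natCast.mp hxq'
  have hxp : (x : ℤ) ∣ p₁ := Int.gcd_dvd_left p₁ q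
  have hyq : y ∣ q := Int.natCast_dvd_natCast.mp (Int.gcd_dvd_right p₂ q)
  have hyp : (y : ℤ) ∣ p₂ := Int.gcd_dvd_left p₂ q
  obtain ⟨m, hm⟩ : ∃ m, q = x * m := ⟨q / x, (Nat.mul_div_cancel' hxq).symm⟩
  obtain ⟨a, ha⟩ := hxp
  -- `a` is prime to `m`
  have ham : IsCoprime a m := by
    rw [Int.isCoprime_iff_gcd_eq_one]
    have e : Int.gcd p₁ q = x * Int.gcd a m := by
      rw [ha, hm, Nat.cast_mul, Int.gcd_mul_left, Int.natAbs_natCast]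
    have e' : x * Int.gcd a m = x * 1 := by rw [mul_one, ← e]
    exact Nat.eq_of_mul_eq_mul_left (Nat.pos_of_ne_zero hx0) e'
  have hmq : m ∣ q := ⟨x, by rw [hm, mul_comm]⟩
  obtain ⟨c, hcq, hca⟩ := exists_unit_lift_x9 hmq ham
  -- `c p₁ ≡ x (mod q)`
  have hcx : (q : ℤ) ∣ c * p₁ - x := by
    obtain ⟨d, hd⟩ := hca
    exact ⟨d, by rw [ha, hm]; push_cast; linear_combination (x : ℤ) * hd⟩
  -- `y ∣ m`
  have hym : y ∣ m := (Nat.Coprime.symm hxy).dvd_of_dvd_mul_left (by rw [← hm]; exact hyq)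
  have hy1 : 1 < y := by omega
  refine ⟨m, c * p₂, hm, ?_, ?_, ?_, ?_, hyp.mul_left c, fun n ↦ lensMultiplicity_unit_mul_congr_x9 q hcq hcx n, ?_, ?_⟩
  · -- `m ≥ y > x > 1`
    have := Nat.le_of_dvd (Nat.pos_of_ne_zero (fun h ↦ hq (by rw [hm, h, mul_zero]))) hym
    omega
  · -- `m ∣ 2x ⟹ y ∣ 2 ⟹ y ≤ 2`
    intro h
    have h1 : (y : ℤ) ∣ 2 * (x : ℤ) := (Int.natCast_dvd_natCast.mpr hym).trans h
    have h2 : y ∣ 2 * x := by exact_mod_cast h1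
    have h3 : y ∣ 2 := (Nat.Coprime.symm hxy).dvd_of_dvd_mul_right h2
    have := Nat.le_of_dvd two_pos h3
    omega
  · -- `w = c p₂` is prime to `x`
    exact (hcq.of_isCoprime_of_dvd_right hxq').mul_left hp₂x
  · -- `m ∣ lw − x ⟹ y ∣ x`
    intro l h
    have h1 : (y : ℤ) ∣ l * (c * p₂) - x := (Int.natCast_dvd_natCast.mpr hym).trans h
    have h2 : (y : ℤ) ∣ (x : ℤ) := by
      have e : (x : ℤ) = l * (c * p₂) - (l * (c * p₂) - x) := by ring
      rw [e]
      exact dvd_sub (Dvd.dvd.mul_left (Dvd.dvd.mul_left hyp _) _) h1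
    have h3 : y ∣ x := by exact_mod_cast h2
    have := Nat.Coprime.eq_one_of_dvd (Nat.Coprime.symm hxy) h3
    omega
  · -- `(p₁, p₂) ~ (x, cp₂)` with multiplier `c'`, `cc' ≡ 1`
    obtain ⟨c', d, hcd⟩ := hcq
    obtain ⟨t, ht⟩ := hcx
    refine ⟨c', fun _ ↦ 1, fun _ ↦ Or.inl rfl, Equiv.refl _, fun i ↦ ?_⟩
    fin_cases i
    · simp only [Equiv.refl_apply, Fin.zero_eta, Matrix.cons_val_zero, one_mul]
      exact Int.modEq_iff_dvd.mpr ⟨-(d * p₁) - c' * t, by linear_combination p₁ * hcd - c' * ht⟩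
    · simp only [Equiv.refl_apply, Fin.mk_one, Matrix.cons_val_one, Matrix.cons_val_zero, one_mul]
      exact Int.modEq_iff_dvd.mpr ⟨-(d * p₂), by linear_combination p₂ * hcd⟩
  · -- `(x, cp₂) ~ (p₁, p₂)` with multiplier `c`
    obtain ⟨t, ht⟩ := hcx
    refine ⟨c, fun _ ↦ 1, fun _ ↦ Or.inl rfl, Equiv.refl _, fun i ↦ ?_⟩
    fin_cases i
    · simp only [Equiv.refl_apply, Fin.zero_eta, Matrix.cons_val_zero, one_mul]
      exact Int.modEq_iff_dvd.mpr ⟨t, by linear_combination ht⟩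
    · simp only [Equiv.refl_apply, Fin.mk_one, Matrix.cons_val_one, Matrix.cons_val_zero, one_mul]
      exact Int.ModEq.refl _

/-! ### §3 LEMMA 3.3: the pole of `F_{L(q; x, w)}` at `γ^{−x}` forces a weight of an isospectral space into `x·(ℤ/q)` -/

/-- **The pole argument of Lemma 3.3**: if `L(q; x, w)` (normal form: `q = xm`, `m ≥ 3`, `m ∤ 2x`, `w` prime to `x`,
`m ∤ lw − x`) is isospectral to `L(q; s₁, s₂)`, then `ls₁ ≡ x` or `ls₂ ≡ x (mod q)` for some `l` — "So there must be an `l`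
such that `ul + x ≡ 0`, or `−ul + x ≡ 0`, or `svl + x ≡ 0`, or `−svl + x ≡ 0 (mod q)`" (else `F₂` has no pole at `γ^x`,
while `lim (z − γ^x)F₁(z) ≠ 0` by Proposition 3.2). [cite: BariHunsicker2019, Lemma 3.3 (proof), Proposition 3.2] -/
theorem exists_mul_congr_of_lensMultiplicity_eq_axis {q x m : ℕ} [NeZero q] (hq : q = x * m) (hm : 3 ≤ m)
    (h2x : ¬ (m : ℤ) ∣ 2 * x) {w : ℤ} (hwx : IsCoprime w x) (hw : ∀ l : ℤ, ¬ (m : ℤ) ∣ l * w - x) {s₁ s₂ : ℤ}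
    (h : ∀ n : ℕ, lensMultiplicity q x w n = lensMultiplicity q s₁ s₂ n) :
    (∃ l : ℤ, (q : ℤ) ∣ l * s₁ - x) ∨ (∃ l : ℤ, (q : ℤ) ∣ l * s₂ - x) := by
  have hq0 : q ≠ 0 := NeZero.ne q
  by_contra hcon
  simp only [not_or, not_exists] at hcon
  obtain ⟨hs₁, hs₂⟩ := hcon
  have hx : x ≠ 0 := fun h' ↦ hq0 (by rw [hq, h', zero_mul])
  have h2 : ¬ (q : ℤ) ∣ 2 * (x : ℤ) := by
    rw [hq, Nat.cast_mul, mul_comm (2 : ℤ), mul_dvd_mul_iff_left (Nat.cast_ne_zero.mpr hx)]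
    intro h'
    have := Int.le_of_dvd two_pos h'
    omega
  have hm₁ : ¬ (m : ℤ) ∣ w - x := by simpa using hw 1
  have hp₁ : ¬ (m : ℤ) ∣ w + x := fun h' ↦
    hw (-1) (by rw [show (-1 : ℤ) * w - x = -(w + x) by ring, dvd_neg]; exact h')
  have t1 := tendsto_one_sub_exp_mul_tsum_lensMultiplicity_axis hq hm hwx hw
  have t2 := tendsto_one_sub_exp_mul_tsum_lensMultiplicity_eq_sum (s₁ := s₁) h2 hs₂
  simp only [h] at t1
  -- no term of `F₂` has a vanishing factor at `e(−x)`
  have hzero : ∀ l ∈ range q, (if (l : ZMod q) * (s₁ : ZMod q) = ((x : ℤ) : ZMod q) ∨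
      (l : ZMod q) * (s₁ : ZMod q) = -((x : ℤ) : ZMod q) then
        1 / ((1 - cexp (2 * π * I * ((((l : ℤ) * s₂ - (x : ℤ) : ℤ)) : ℂ) / q)) *
          (1 - cexp (2 * π * I * ((-((l : ℤ) * s₂ + (x : ℤ)) : ℤ) : ℂ) / q))) else 0) = 0 := by
    intro l _
    rw [if_neg]
    rintro (h' | h')
    · refine hs₁ l ((ZMod.intCast_zmod_eq_zero_iff_dvd _ _).mp ?_)
      push_cast at h' ⊢
      rw [h', sub_self]
    · refine hs₁ (-(l : ℤ)) ((ZMod.intCast_zmod_eq_zero_iff_dvd _ _).mp ?_)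
      push_cast at h' ⊢
      rw [neg_mul, h', neg_neg, sub_self]
  rw [Finset.sum_congr rfl hzero, Finset.sum_const_zero, mul_zero] at t2
  haveI := (nhdsWithin_ball_le_and_neBot_x9 (norm_exp_intCast_x9 q (-(x : ℤ)))).2
  exact residue_axis_ne_zero hq hm h2x hm₁ hp₁ (tendsto_nhds_unique t1 t2)

/-- **LEMMA 3.3 (Bari–Hunsicker 2019), the part that is needed: the first weights of the two normal forms agree.** "Suppose
`L₁ = L(q:x, py)` and `L₂ = L(q:u, sv)` are two isospectral lens orbifolds where `gcd(x, q) = x`, `gcd(py, q) = y`,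
`gcd(u, q) = u` and `gcd(sv, q) = v`. Then either `u = x` and `v = y`, or `u = y` and `v = x`." With the normalization `x < y`,
`u < v` of the Remark ("we can assume that `y > x` and `v > u`") the pole argument gives `u ∣ x` or `v ∣ x`, and symmetrically
`x ∣ u` or `y ∣ u`; as `gcd(x, y) = gcd(u, v) = 1` and all four exceed `1`, only `u = x` is possible. (The source derives also
`v = y` by the same argument "where we swap the roles of `x` and `y`"; that second application of Proposition 3.2 is not
needed below — the Case-5 congruence only uses the common first weight `x`.) [cite: BariHunsicker2019, Lemma 3.3] -/
theorem eq_of_lensMultiplicity_eq_of_normalForms {q x m u m' : ℕ} [NeZero q] (hq : q = x * m) (hm : 3 ≤ m)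
    (h2x : ¬ (m : ℤ) ∣ 2 * x) {w₁ : ℤ} (hw₁x : IsCoprime w₁ x) (hw₁ : ∀ l : ℤ, ¬ (m : ℤ) ∣ l * w₁ - x)
    {y : ℕ} (hyw : (y : ℤ) ∣ w₁) (hyq : y ∣ q) (hxy : Nat.Coprime x y) (hxy' : x < y) (hx1 : 1 < x)
    (hq' : q = u * m') (hm' : 3 ≤ m') (h2u : ¬ (m' : ℤ) ∣ 2 * u) {w₂ : ℤ} (hw₂u : IsCoprime w₂ u)
    (hw₂ : ∀ l : ℤ, ¬ (m' : ℤ) ∣ l * w₂ - u)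
    {v : ℕ} (hvw : (v : ℤ) ∣ w₂) (hvq : v ∣ q) (huv : Nat.Coprime u v) (huv' : u < v) (hu1 : 1 < u)
    (h : ∀ n : ℕ, lensMultiplicity q x w₁ n = lensMultiplicity q u w₂ n) : x = u := by
  have hxq : x ∣ q := ⟨m, hq⟩
  have huq : u ∣ q := ⟨m', hq'⟩
  -- (A): `u ∣ x` or `v ∣ x`
  have hA : u ∣ x ∨ v ∣ x := by
    rcases exists_mul_congr_of_lensMultiplicity_eq_axis hq hm h2x hw₁x hw₁ h with ⟨l, hl⟩ | ⟨l, hl⟩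
    · refine Or.inl (Int.natCast_dvd_natCast.mp ?_)
      have e : (x : ℤ) = l * u - (l * u - x) := by ring
      rw [e]
      exact dvd_sub (dvd_mul_left _ _) ((Int.natCast_dvd_natCast.mpr huq).trans hl)
    · refine Or.inr (Int.natCast_dvd_natCast.mp ?_)
      have e : (x : ℤ) = l * w₂ - (l * w₂ - x) := by ring
      rw [e]
      exact dvd_sub (hvw.mul_left _) ((Int.natCast_dvd_natCast.mpr hvq).trans hl)
  -- (B): `x ∣ u` or `y ∣ u`
  have hB : x ∣ u ∨ y ∣ u := by
    rcases exists_mul_congr_of_lensMultiplicity_eq_axis hq' hm' h2u hw₂u hw₂ (fun n ↦ (h n).symm) with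
      ⟨l, hl⟩ | ⟨l, hl⟩
    · refine Or.inl (Int.natCast_dvd_natCast.mp ?_)
      have e : (u : ℤ) = l * x - (l * x - u) := by ring
      rw [e]
      exact dvd_sub (dvd_mul_left _ _) ((Int.natCast_dvd_natCast.mpr hxq).trans hl)
    · refine Or.inr (Int.natCast_dvd_natCast.mp ?_)
      have e : (u : ℤ) = l * w₁ - (l * w₁ - u) := by ring
      rw [e]
      exact dvd_sub (hyw.mul_left _) ((Int.natCast_dvd_natCast.mpr hyq).trans hl)
  rcases hA with hA | hA <;> rcases hB with hB | hB
  · exact Nat.dvd_antisymm hB hA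
  · -- `y ∣ u ∣ x`
    have := Nat.Coprime.eq_one_of_dvd (Nat.Coprime.symm hxy) (hB.trans hA)
    omega
  · -- `v ∣ x ∣ u`
    have := Nat.Coprime.eq_one_of_dvd (Nat.Coprime.symm huv) (hA.trans hB)
    omega
  · -- `v ≤ x < y ≤ u < v`
    have h1 := Nat.le_of_dvd (by omega) hA
    have h2 := Nat.le_of_dvd (by omega) hB
    omega

/-! ### §4 THEOREM 3.1, Case 5: no weight prime to `q` -/

/-- Case 5 for both weight pairs ordered by `gcd(·, q)`. [cite: BariHunsicker2019, Theorem 3.1 (Case 5), Lemma 3.3] -/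
private theorem case5_ordered_x9 {q : ℕ} [NeZero q] {p₁ p₂ s₁ s₂ : ℤ} (hp : (Int.gcd p₁ p₂).Coprime q)
    (hs : (Int.gcd s₁ s₂).Coprime q) (h1p : 1 < Int.gcd p₁ q) (h12p : Int.gcd p₁ q < Int.gcd p₂ q)
    (h1s : 1 < Int.gcd s₁ q) (h12s : Int.gcd s₁ q < Int.gcd s₂ q)
    (h : ∀ n : ℕ, lensMultiplicity q p₁ p₂ n = lensMultiplicity q s₁ s₂ n) :
    LensWeightsEquivalent q ![p₁, p₂] ![s₁, s₂] := by
  obtain ⟨m, w₁, hq, hm, h2x, hw₁x, hw₁, hyw, hmult₁, he₁, -⟩ := normalForm_x9 hp h1p h12p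
  obtain ⟨m', w₂, hq', hm', h2u, hw₂u, hw₂, hvw, hmult₂, -, he₂⟩ := normalForm_x9 hs h1s h12s
  obtain ⟨hxy, -⟩ := coprime_gcd_gcd_x9 hp
  obtain ⟨huv, -⟩ := coprime_gcd_gcd_x9 hs
  have h' : ∀ n, lensMultiplicity q (Int.gcd p₁ q : ℕ) w₁ n = lensMultiplicity q (Int.gcd s₁ q : ℕ) w₂ n :=
    fun n ↦ by rw [← hmult₁, ← hmult₂, h n]
  have hxu : Int.gcd p₁ q = Int.gcd s₁ q :=
    eq_of_lensMultiplicity_eq_of_normalForms hq hm h2x hw₁x hw₁ hyw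
      (Int.natCast_dvd_natCast.mp (Int.gcd_dvd_right p₂ q)) hxy h12p h1p hq' hm' h2u hw₂u hw₂ hvw
      (Int.natCast_dvd_natCast.mp (Int.gcd_dvd_right s₂ q)) huv h12s h1s h'
  rw [← hxu] at hq' hw₂u hw₂ h' he₂
  have hmm : m = m' := Nat.eq_of_mul_eq_mul_left (by omega) (hq.symm.trans hq')
  subst hmm
  exact (he₁.trans (lensWeightsEquivalent_of_lensMultiplicity_eq_axis hq hm h2x hw₁x hw₂u hw₁ hw₂ h')).trans he₂

/-- `gcd(p, q) > 1` for a weight `p` NOT prime to `q` (`q ≥ 1`). [folklore] -/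
private theorem one_lt_gcd_x9 {q : ℕ} [NeZero q] {p : ℤ} (hp : ¬ IsCoprime p q) : 1 < Int.gcd p q := by
  have h1 : Int.gcd p q ≠ 1 := fun h ↦ hp (Int.isCoprime_iff_gcd_eq_one.mpr h)
  have h0 : Int.gcd p q ≠ 0 := fun h ↦ NeZero.ne q (by
    have := (Int.gcd_eq_zero_iff.mp h).2
    exact_mod_cast this)
  omega

/-- **THEOREM 3.1 (Bari–Hunsicker 2019), Case 5: "None of `p₁`, `p₂`, `s₁` and `s₂` is coprime to `q`."** If the orbifold lens
spaces `L₁ = L(q : p₁, p₂)`, `L₂ = L(q : s₁, s₂)` (`|G| = q`: `gcd(p₁, p₂, q) = 1 = gcd(s₁, s₂, q)`) have no weight prime to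
`q` and are isospectral, then they are isometric (Ikeda's criterion / Corollary 2.2). Route: both spaces are brought to the
normal forms `L(q; x, w₁)`, `L(q; u, w₂)` (`x = min(gcd(p_i, q))`, `u = min(gcd(s_i, q))`); Lemma 3.3 gives `x = u`; the
residues at `γ^{−x}` then give `w₁ ≡ ±w₂ (mod q/x)` and the isometry `l = 1 + tq/x`.
[cite: BariHunsicker2019, Theorem 3.1 (Case 5), Lemma 3.3, Proposition 3.2, Corollary 2.2] -/
theorem lensWeightsEquivalent_of_lensMultiplicity_eq_of_forall_not_isCoprime {q : ℕ} [NeZero q] {p₁ p₂ s₁ s₂ : ℤ}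
    (hp : (Int.gcd p₁ p₂).Coprime q) (hs : (Int.gcd s₁ s₂).Coprime q) (hp₁ : ¬ IsCoprime p₁ q)
    (hp₂ : ¬ IsCoprime p₂ q) (hs₁ : ¬ IsCoprime s₁ q) (hs₂ : ¬ IsCoprime s₂ q)
    (h : ∀ n : ℕ, lensMultiplicity q p₁ p₂ n = lensMultiplicity q s₁ s₂ n) :
    LensWeightsEquivalent q ![p₁, p₂] ![s₁, s₂] := by
  -- order the `s`-side
  suffices key : ∀ {s₁ s₂ : ℤ}, (Int.gcd s₁ s₂).Coprime q → ¬ IsCoprime s₁ q → ¬ IsCoprime s₂ q →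
      Int.gcd s₁ q < Int.gcd s₂ q → (∀ n : ℕ, lensMultiplicity q p₁ p₂ n = lensMultiplicity q s₁ s₂ n) →
      LensWeightsEquivalent q ![p₁, p₂] ![s₁, s₂] by
    have hne : Int.gcd s₁ q ≠ Int.gcd s₂ q := fun e ↦ by
      have h1 := (coprime_gcd_gcd_x9 hs).1
      rw [e, Nat.coprime_self] at h1
      have := one_lt_gcd_x9 hs₂
      omega
    rcases lt_or_gt_of_ne hne with hlt | hgt
    · exact key hs hs₁ hs₂ hlt h
    · exact swap_right_x9 (key (by rwa [Int.gcd_comm]) hs₂ hs₁ hgt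
        fun n ↦ (h n).trans (lensMultiplicity_swap q s₁ s₂ n))
  intro s₁ s₂ hs hs₁ hs₂ hlt h
  -- order the `p`-side
  have hne : Int.gcd p₁ q ≠ Int.gcd p₂ q := fun e ↦ by
    have h1 := (coprime_gcd_gcd_x9 hp).1
    rw [e, Nat.coprime_self] at h1
    have := one_lt_gcd_x9 hp₂
    omega
  rcases lt_or_gt_of_ne hne with hlt' | hgt'
  · exact case5_ordered_x9 hp hs (one_lt_gcd_x9 hp₁) hlt' (one_lt_gcd_x9 hs₁) hlt h
  · exact swap_left_x9 (case5_ordered_x9 (by rwa [Int.gcd_comm]) hs (one_lt_gcd_x9 hp₂) hgt' (one_lt_gcd_x9 hs₁) hlt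
      fun n ↦ (lensMultiplicity_swap q p₂ p₁ n).trans (h n))

/-! ### §5 THEOREM 3.1 for three-dimensional orbifold lens spaces (Cases 2–5) -/

/-- **THEOREM 3.1 (Bari–Hunsicker 2019). "Given two 3-dimensional lens spaces `L₁ = L(q: p₁, p₂)` and `L₂ = L(q: s₁, s₂)`. If
`L₁` is isospectral to `L₂`, then the two lens spaces are isometric."** Formalised for all pairs of orbifold lens spaces with
`|G| = q` (`gcd(p₁, p₂, q) = 1 = gcd(s₁, s₂, q)`) that are NOT both manifolds (Cases 2, 3, 4, 5 of the proof; Case 1, both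
manifolds, is the theorem of Ikeda–Yamamoto 1979 / Yamamoto 1980, in the tree for `q` a prime power, twice a prime power,
`q ≤ 10`, and odd `q` with `(p₁ ± p₂, q) = 1`): isospectral ⟹ Ikeda's criterion `LensWeightsEquivalent q (p₁, p₂) (s₁, s₂)`,
whose multiplier is prime to `q` (`LensWeightsEquivalent.exists_isCoprime_of_coprime_gcd`) — the isometry criterion of
Corollary 2.2. Case 2 is `isCoprime_of_lensMultiplicity_eq` (by the pole at `z = 1`, in place of the source's [GR]), Cases 3–4
`lensWeightsEquivalent_of_lensMultiplicity_eq_orbifold` (residues at `γ^k`, `k` prime to `q`), Case 5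
`lensWeightsEquivalent_of_lensMultiplicity_eq_of_forall_not_isCoprime` (residue at `γ^x` in closed form).
[cite: BariHunsicker2019, Theorem 3.1, Corollary 2.2] -/
theorem lensWeightsEquivalent_of_lensMultiplicity_eq_of_not_manifolds {q : ℕ} [NeZero q] {p₁ p₂ s₁ s₂ : ℤ}
    (hp : (Int.gcd p₁ p₂).Coprime q) (hs : (Int.gcd s₁ s₂).Coprime q)
    (h1 : ¬ (IsCoprime p₁ q ∧ IsCoprime p₂ q ∧ IsCoprime s₁ q ∧ IsCoprime s₂ q))
    (h : ∀ n : ℕ, lensMultiplicity q p₁ p₂ n = lensMultiplicity q s₁ s₂ n) :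
    LensWeightsEquivalent q ![p₁, p₂] ![s₁, s₂] := by
  by_cases hpu : IsCoprime p₁ q ∨ IsCoprime p₂ q
  · -- `L₁` has a weight prime to `q`: Cases 2–4, unless `L₂` is a manifold — then so is `L₁` (Case 2), i.e. Case 1
    by_cases hsm : IsCoprime s₁ q ∧ IsCoprime s₂ q
    · obtain ⟨hp₁, hp₂⟩ := isCoprime_of_lensMultiplicity_eq hsm.1 hsm.2 fun n ↦ (h n).symm
      exact absurd ⟨hp₁, hp₂, hsm.1, hsm.2⟩ h1
    · exact lensWeightsEquivalent_of_lensMultiplicity_eq_of_isCoprime_or hpu hsm h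
  · obtain ⟨hp₁, hp₂⟩ := not_or.mp hpu
    by_cases hsm : IsCoprime s₁ q ∧ IsCoprime s₂ q
    · -- Case 2 with the roles exchanged: impossible
      obtain ⟨n, hn⟩ := exists_lensMultiplicity_ne_of_isCoprime_of_not hsm.1 hsm.2 (fun h' ↦ hp₁ h'.1)
      exact absurd (h n).symm hn
    by_cases hsu : IsCoprime s₁ q ∨ IsCoprime s₂ q
    · -- Case 4 with the roles exchanged: impossible
      have hx : Xor (IsCoprime s₁ q) (IsCoprime s₂ q) := by
        rcases hsu with h' | h'
        · exact Or.inl ⟨h', fun h'' ↦ hsm ⟨h', h''⟩⟩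
        · exact Or.inr ⟨h', fun h'' ↦ hsm ⟨h'', h'⟩⟩
      obtain ⟨n, hn⟩ := exists_lensMultiplicity_ne_of_not_isCoprime hx hp₁ hp₂
      exact absurd (h n).symm hn
    · obtain ⟨hs₁, hs₂⟩ := not_or.mp hsu
      exact lensWeightsEquivalent_of_lensMultiplicity_eq_of_forall_not_isCoprime hp hs hp₁ hp₂ hs₁ hs₂ h

/-- **THEOREM 3.1 with COROLLARY 2.2's conclusion verbatim**: under the same hypotheses there are `l` COPRIME WITH `q`, signs
`e_i ∈ {−1, 1}` and a permutation `σ` with `p_{σ(i)} ≡ e_i l s_i (mod q)` — "`L` is isometric to `L'`".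
[cite: BariHunsicker2019, Theorem 3.1, Corollary 2.2] -/
theorem exists_isCoprime_of_lensMultiplicity_eq_of_not_manifolds {q : ℕ} [NeZero q] {p₁ p₂ s₁ s₂ : ℤ}
    (hp : (Int.gcd p₁ p₂).Coprime q) (hs : (Int.gcd s₁ s₂).Coprime q)
    (h1 : ¬ (IsCoprime p₁ q ∧ IsCoprime p₂ q ∧ IsCoprime s₁ q ∧ IsCoprime s₂ q))
    (h : ∀ n : ℕ, lensMultiplicity q p₁ p₂ n = lensMultiplicity q s₁ s₂ n) :
    ∃ l : ℤ, IsCoprime l q ∧ ∃ e : Fin 2 → ℤ, (∀ i, e i = 1 ∨ e i = -1) ∧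
      ∃ σ : Equiv.Perm (Fin 2), ∀ i, (![p₁, p₂] : Fin 2 → ℤ) (σ i) ≡ e i * l * (![s₁, s₂] : Fin 2 → ℤ) i [ZMOD q] :=
  (lensWeightsEquivalent_of_lensMultiplicity_eq_of_not_manifolds hp hs h1 h).exists_isCoprime_of_coprime_gcd hp

end Literature.Analysis.InnerProduct
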